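import Literature.MathematicalPhysics.QuantumFieldTheory.Balaban1983to89.B10Eq18SigmaEven
import Literature.MathematicalPhysics.QuantumFieldTheory.Balaban1983to89.B12SemisimpleFiniteCentre
import Literature.MathematicalPhysics.QuantumFieldTheory.Balaban1983to89.B12SpecialUnitaryClosedSubgroup

/-!
# `Balaban1983to89.B10Eq18SigmaEvenSuN` — T. Bałaban, *Ultraviolet stability of three-dimensional lattice pure gauge
# field theories*, Commun. Math. Phys. **102** (1985) 255–275 [Balaban1985UV3], p. 260 «σ(A) is an … even function
# of A» AT THE GROUPS OF THEOREM 1 p. 257 («a semi-simple compact Lie group G», print's example `G = SU(2)`): the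
# abstract evenness theorems of `B10Eq18SigmaEven` INSTANTIATED at `𝔰𝔲(N)`, `𝔰𝔩(N, ℂ) = 𝔰𝔲(N)ᶜ`, and at the Lie algebra
# of every closed connected `G ≤ U(N)` with finite centre, through the tree's semisimplicity instances (theorems only)

statement-level skeleton of published theorems with citation tags; proofs where landed; nothing here is a claim
about the Yang–Mills mass gap

PDF held: `paper:balaban1985-cmp102-uv-stability-3d`; p. 257 [PDF 3] (Theorem 1) and p. 260 [PDF 6] (the `σ` paragraph)
re-read by this seat (render `…-p006-x2.png`, text layer `p0003.txt`), 2026-08-22.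

WHAT IS REPRODUCED.  Mega-formalization `lit-balaban` (HOME `run/shared/lean/pub/lit-balaban/`), unit `lit-balaban-r07`
gen 17, file 2.  SKELETON rows: **B10.Eq21** (depends-on cell: the p. 260 sentence on `σ`), narrative E16/E18, and
row **B10.Thm1** (the hypothesis «semi-simple compact Lie group G» — used here, not the theorem).  File 1
(`B10Eq18SigmaEven`, p316210) proved «σ even» in the `B13HaarSigma` dictionary `σ/σ₀ = σrel(T) = det φ(T)` from
`tr ad x = 0`, and `tr ad x = 0` for every Lie algebra carrying Mathlib's `LieAlgebra.IsSemisimple`; its HONEST SCOPE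
(iii) recorded that the abstract theorems were not instantiated at the classical algebras.  THIS FILE instantiates them
BY NAME through instances already in the tree (nothing re-proved): `Literature.Algebra.Lie.CompactKillingForm.su n`
(`𝔰𝔲(N)`, instance `instIsSemisimpleSu`, [Hall2015] Ex. 7.3 / [BrockerTomDieck1985] V (5.13)),
`LieAlgebra.SpecialLinear.sl n ℂ` (`𝔰𝔩(N, ℂ) = 𝔰𝔲(N)ᶜ`, `Literature.Algebra.Lie.SpecialLinearKilling.instIsSemisimpleSl`,
`B12LieComplexification.complexify_su_eq_sl`), and p24's group-level packaging `B12LieComplexification.lieSubalgebra G hG`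
/ `lieC G hG` of the Lie algebra 𝐠 (and 𝐠ᶜ) of a closed `G ≤ U(N)` with
`B12SemisimpleFiniteCentre.isSemisimple_lieSubalgebra_iff_center_finite` («G semisimple ⇔ Z(G) finite», closed connected
`G`, [BrockerTomDieck1985] V (7.13)) and `B12SpecialUnitaryClosedSubgroup.specialUnitarySubgroup n` (`SU(N) ≤ U(N)`,
instance `isSemisimple_lieSubalgebra_specialUnitarySubgroup`).

THE PRINTED TEXT.  p. 257 (verbatim): *"Theorem 1. The lattice approximations of the three-dimensional pure Yang-Mills
theory with a semi-simple compact group Lie G are ultraviolet stable in the sense that the sequence of densities ρ_k,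
constructed by the inductive definition (2), with ρ₀ given by (1), satisfies the bounds (5).  The above theorem can be
generalized to a much wider class of compact Lie groups, as it will be clear from the proof. We have restricted
ourselves to semi-simple groups because then the proof is particularly simple."*  p. 260 (verbatim): *"For example for
SU(2) we have σ(A) = 1/2π² (sin|A|/|A|)², … Generally σ(A) is an analytic, positive, even function of A in a
neighbourhood of 0∈𝔤, invariant with respect to the adjoint representation of the group G …"*.

HONEST SCOPE.  (i) As in file 1 and `B13HaarSigma`, the identification of `det φ(−ad X)` with the Haar density
([Helgason2000] Ch. I §1 Thm. 1.14) is quoted, not formalised; the theorems concern `σrel` of the matrix of `ad` in a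
basis (real bases cast into `ℂ`, or complex bases of 𝐠ᶜ — the «basis of `𝔤ᶜ`» of `B13HaarSigma`'s dictionary).
(ii) The semisimplicity inputs are the tree's instances/theorems cited above (p24 lineage, cells B12/B13), consumed by
name.  (iii) The compact NON-semisimple case (p. 257 «much wider class», e.g. `U(N)`) is file 1's `trace_adMat_eq_zero`
at the level of `gl(N)` only.  0 definitions, 0 new named facts.
-/

noncomputable section

namespace Literature.MathematicalPhysics.QuantumFieldTheory.Balaban1983to89.B10Eq18SigmaEvenSuN

open B13HaarSigma (sigmaRel)
open B10Eq18SigmaEven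
open Literature.Algebra.Lie.CompactKillingForm (su)
open LieAlgebra.SpecialLinear (sl)
open B12LieComplexification (lieSubalgebra lieC)
open B12SemisimpleFiniteCentre (isSemisimple_lieSubalgebra_iff_center_finite isSemisimple_lieC_iff_center_finite)
open B12SpecialUnitaryClosedSubgroup (specialUnitarySubgroup isClosed_specialUnitarySubgroup)

variable {ι : Type*} [Fintype ι] [DecidableEq ι] {n : Type*} [Fintype n] [DecidableEq n]

/-! ## §1  Print's example: `𝔤 = 𝔰𝔲(N)` and its complexification `𝔤ᶜ = 𝔰𝔩(N, ℂ)` -/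

/-- **`tr ad x = 0` on `𝔰𝔲(N)`** (file 1's `trace_ad_eq_zero` at the tree's instance `instIsSemisimpleSu`): the
unimodularity of `SU(N)` at the Lie-algebra level. [cite: Balaban1985UV3, Thm 1 p. 257, p. 260]
[cite: Helgason2000, Ch. I §1 Prop. 1.6 p. 90] -/
theorem trace_ad_su_eq_zero (x : su n) : LinearMap.trace ℝ (su n) (LieAlgebra.ad ℝ (su n) x) = 0 :=
  trace_ad_eq_zero x

/-- **«σ(A) is an … even function of A» for `G = SU(N)`** (print's example `SU(2)` included): in any real basis `b` of
`𝔰𝔲(N)`, `σrel` of the (complex-cast) matrix of `ad(−x)` equals that of `ad x`. [cite: Balaban1985UV3, p. 260]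
[cite: Helgason2000, Ch. I §1 Prop. 1.6 p. 90] -/
theorem sigmaRel_ad_even_su (b : Module.Basis ι ℝ (su n)) (x : su n) :
    sigmaRel ((LinearMap.toMatrix b b (LieAlgebra.ad ℝ (su n) (-x))).map (algebraMap ℝ ℂ)) =
      sigmaRel ((LinearMap.toMatrix b b (LieAlgebra.ad ℝ (su n) x)).map (algebraMap ℝ ℂ)) :=
  sigmaRel_ad_even_real b x

/-- **`tr ad x = 0` on `𝔰𝔩(N, ℂ) = 𝔰𝔲(N)ᶜ`** (the «basis of `𝔤ᶜ`» setting of `B13HaarSigma`; tree instance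
`SpecialLinearKilling.instIsSemisimpleSl`). [cite: Balaban1985UV3, p. 260] [cite: Helgason2000, Ch. I §1 Prop. 1.6 p. 90] -/
theorem trace_ad_sl_eq_zero (x : sl n ℂ) : LinearMap.trace ℂ (sl n ℂ) (LieAlgebra.ad ℂ (sl n ℂ) x) = 0 :=
  trace_ad_eq_zero x

/-- **«σ even» on `𝔰𝔩(N, ℂ) = 𝔰𝔲(N)ᶜ`**, any complex basis. [cite: Balaban1985UV3, p. 260]
[cite: Helgason2000, Ch. I §1 Prop. 1.6 p. 90] -/
theorem sigmaRel_ad_even_sl (b : Module.Basis ι ℂ (sl n ℂ)) (x : sl n ℂ) :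
    sigmaRel (LinearMap.toMatrix b b (LieAlgebra.ad ℂ (sl n ℂ) (-x))) =
      sigmaRel (LinearMap.toMatrix b b (LieAlgebra.ad ℂ (sl n ℂ) x)) :=
  sigmaRel_ad_even b x

/-! ## §2  `SU(N)` as the closed subgroup `specialUnitarySubgroup n ≤ U(N)`: its Lie algebra 𝐠 and 𝐠ᶜ (tree packaging) -/

/-- **«σ even» on the Lie algebra 𝐠 of `SU(N) ≤ U(N)`** in p24's packaging `lieSubalgebra (specialUnitarySubgroup n) _`
(`= 𝔰𝔲(N)`, `B12SpecialUnitaryClosedSubgroup.lieSubalgebra_specialUnitarySubgroup`; instance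
`isSemisimple_lieSubalgebra_specialUnitarySubgroup`). [cite: Balaban1985UV3, Thm 1 p. 257, p. 260]
[cite: Helgason2000, Ch. I §1 Prop. 1.6 p. 90] -/
theorem sigmaRel_ad_even_lie_specialUnitary [Nonempty n]
    (b : Module.Basis ι ℝ (lieSubalgebra (specialUnitarySubgroup n) (isClosed_specialUnitarySubgroup n)))
    (x : lieSubalgebra (specialUnitarySubgroup n) (isClosed_specialUnitarySubgroup n)) :
    sigmaRel ((LinearMap.toMatrix b b (LieAlgebra.ad ℝ _ (-x))).map (algebraMap ℝ ℂ)) =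
      sigmaRel ((LinearMap.toMatrix b b (LieAlgebra.ad ℝ _ x)).map (algebraMap ℝ ℂ)) :=
  sigmaRel_ad_even_real b x

/-- **«σ even» on 𝐠ᶜ of `SU(N) ≤ U(N)`** (`lieC (specialUnitarySubgroup n) _ = 𝔰𝔩(N, ℂ)`; instance
`isSemisimple_lieC_specialUnitarySubgroup`). [cite: Balaban1985UV3, Thm 1 p. 257, p. 260]
[cite: Helgason2000, Ch. I §1 Prop. 1.6 p. 90] -/
theorem sigmaRel_ad_even_lieC_specialUnitary [Nonempty n]
    (b : Module.Basis ι ℂ (lieC (specialUnitarySubgroup n) (isClosed_specialUnitarySubgroup n)))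
    (x : lieC (specialUnitarySubgroup n) (isClosed_specialUnitarySubgroup n)) :
    sigmaRel (LinearMap.toMatrix b b (LieAlgebra.ad ℂ _ (-x))) = sigmaRel (LinearMap.toMatrix b b (LieAlgebra.ad ℂ _ x)) :=
  sigmaRel_ad_even b x

/-! ## §3  Theorem 1's class in the tree's reading: closed connected `G ≤ U(N)` with finite centre (⇔ 𝐠 semisimple) -/

section ClosedSubgroup

variable (G : Subgroup (Matrix.unitaryGroup n ℂ)) (hG : IsClosed (G : Set (Matrix.unitaryGroup n ℂ)))

/-- **`tr ad x = 0` on the Lie algebra 𝐠 of a «semi-simple compact» `G`**: for every closed connected `G ≤ U(N)` with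
finite centre (⇔ 𝐠 semisimple, `B12SemisimpleFiniteCentre.isSemisimple_lieSubalgebra_iff_center_finite`).
[cite: Balaban1985UV3, Thm 1 p. 257, p. 260] [cite: Helgason2000, Ch. I §1 Prop. 1.6 p. 90] -/
theorem trace_ad_lieSubalgebra_eq_zero (hconn : IsConnected (G : Set (Matrix.unitaryGroup n ℂ)))
    (hZ : (Subgroup.center G : Set G).Finite) (x : lieSubalgebra G hG) :
    LinearMap.trace ℝ (lieSubalgebra G hG) (LieAlgebra.ad ℝ (lieSubalgebra G hG) x) = 0 :=
  haveI := (isSemisimple_lieSubalgebra_iff_center_finite G hG hconn).2 hZ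
  trace_ad_eq_zero x

/-- **«σ(A) is an … even function of A» for every «semi-simple compact Lie group G» of Theorem 1, read as a closed
connected `G ≤ U(N)` with finite centre**: in any real basis of 𝐠, `σrel` of the matrix of `ad(−x)` equals that of
`ad x`. [cite: Balaban1985UV3, Thm 1 p. 257, p. 260] [cite: Helgason2000, Ch. I §1 Prop. 1.6 p. 90] -/
theorem sigmaRel_ad_even_lieSubalgebra (hconn : IsConnected (G : Set (Matrix.unitaryGroup n ℂ)))
    (hZ : (Subgroup.center G : Set G).Finite) (b : Module.Basis ι ℝ (lieSubalgebra G hG)) (x : lieSubalgebra G hG) :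
    sigmaRel ((LinearMap.toMatrix b b (LieAlgebra.ad ℝ (lieSubalgebra G hG) (-x))).map (algebraMap ℝ ℂ)) =
      sigmaRel ((LinearMap.toMatrix b b (LieAlgebra.ad ℝ (lieSubalgebra G hG) x)).map (algebraMap ℝ ℂ)) :=
  haveI := (isSemisimple_lieSubalgebra_iff_center_finite G hG hconn).2 hZ
  sigmaRel_ad_even_real b x

/-- The same with the semisimplicity of 𝐠 as an instance hypothesis (no connectedness needed).
[cite: Balaban1985UV3, Thm 1 p. 257, p. 260] [cite: Helgason2000, Ch. I §1 Prop. 1.6 p. 90] -/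
theorem sigmaRel_ad_even_lieSubalgebra_of_isSemisimple [LieAlgebra.IsSemisimple ℝ (lieSubalgebra G hG)]
    (b : Module.Basis ι ℝ (lieSubalgebra G hG)) (x : lieSubalgebra G hG) :
    sigmaRel ((LinearMap.toMatrix b b (LieAlgebra.ad ℝ (lieSubalgebra G hG) (-x))).map (algebraMap ℝ ℂ)) =
      sigmaRel ((LinearMap.toMatrix b b (LieAlgebra.ad ℝ (lieSubalgebra G hG) x)).map (algebraMap ℝ ℂ)) :=
  sigmaRel_ad_even_real b x

/-- **«σ even» on 𝐠ᶜ** (the complex «basis of `𝔤ᶜ`» of `B13HaarSigma`'s dictionary) for every closed connected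
`G ≤ U(N)` with finite centre (`isSemisimple_lieC_iff_center_finite`). [cite: Balaban1985UV3, Thm 1 p. 257, p. 260]
[cite: Helgason2000, Ch. I §1 Prop. 1.6 p. 90] -/
theorem sigmaRel_ad_even_lieC (hconn : IsConnected (G : Set (Matrix.unitaryGroup n ℂ)))
    (hZ : (Subgroup.center G : Set G).Finite) (b : Module.Basis ι ℂ (lieC G hG)) (x : lieC G hG) :
    sigmaRel (LinearMap.toMatrix b b (LieAlgebra.ad ℂ (lieC G hG) (-x))) =
      sigmaRel (LinearMap.toMatrix b b (LieAlgebra.ad ℂ (lieC G hG) x)) :=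
  haveI := (isSemisimple_lieC_iff_center_finite G hG hconn).2 hZ
  sigmaRel_ad_even b x

/-- `tr ad z = 0` on 𝐠ᶜ for every closed connected `G ≤ U(N)` with finite centre.
[cite: Balaban1985UV3, Thm 1 p. 257, p. 260] [cite: Helgason2000, Ch. I §1 Prop. 1.6 p. 90] -/
theorem trace_ad_lieC_eq_zero (hconn : IsConnected (G : Set (Matrix.unitaryGroup n ℂ)))
    (hZ : (Subgroup.center G : Set G).Finite) (z : lieC G hG) :
    LinearMap.trace ℂ (lieC G hG) (LieAlgebra.ad ℂ (lieC G hG) z) = 0 :=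
  haveI := (isSemisimple_lieC_iff_center_finite G hG hconn).2 hZ
  trace_ad_eq_zero z

end ClosedSubgroup

end Literature.MathematicalPhysics.QuantumFieldTheory.Balaban1983to89.B10Eq18SigmaEvenSuN
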